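import Summits.BirchSwinnertonDyer.BirchSwinnertonDyer.Theorems.PrintCFramBottomClassIndexLawFiveLeKummerManyCharacters
import Summits.BirchSwinnertonDyer.BirchSwinnertonDyer.Theorems.PrintCFramBottomClassIndexLawFiveLeSelmerCountCharacterSupplyFamily
import Summits.BirchSwinnertonDyer.BirchSwinnertonDyer.Theorems.PrintCFramBottomClassIndexLawFiveLeKummerEigenclassOfComponent
import HarnessLib

/-!
# Route `PrintCFram`, crux C2 `BottomClassIndexLawFiveLe` (stmt-BirchSwinnertonDyer-20372), line
# `eisenstein-resource-bdp-line` (registry v22, stubs B1-level `stub_bsdp_of_level` / B1-sha `stub_bsdp_of_sha`):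
# **THE `p`-RANK LOWER BOUND OF THE B1-sha CENSUS** — on a rank-one CM-ramified member in CASE R with (LA),
# **`p^{r+1} ≤ #Sel_p(W/ℚ)` and `p^r ≤ #Ш(W/ℚ)[p]` whenever `p^r ≤ #(e_{ω∘ψ̄}(ℤ_p ⊗ Cl K))[p]`**, i.e.
# `dim_𝔽_p Ш(W)[p] ≥ rank_p e_{θ_e}(ℤ_p ⊗ Cl K)` — the LOWER twin of w4 g10's `#Sel_p ≤ p²·t²` (p685197)
# (cell `bsd-print-cfram`, width seat `bsd-line-cfram-p1-w7` g5; helper `--supports` 20372; 0 defs, 0 facts, 0 sorry;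
# §3 CONDITIONAL on the tree's named fact `localEulerPoincareCharacteristic ℚ_v` exactly as `…SelmerCountCoalignedOfLocal`)

HONEST FRAMING. Nothing about BSD is proved here; no summit statement is proved by this seat; no stub of the registered
skeleton is closed. This file assembles the p-RANK LOWER BOUND (HOME/HANDOFF §w4 g10 FINAL, successor item (b); step 4/4):
§1 runs w7 g4's dictionary `KummerRadical.exists_eigenclass_of_classGroupChiComponent_ne_bot` (p684702) for a FAMILY — from
`p^r ≤ #(e_θ(ℤ_p ⊗ Cl K))[p]` it extracts `r` `𝔽_p`-INDEPENDENT exact `e`-eigenclasses in `Cl(K)[p]` (the `p`-torsion of the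
component is an `𝔽_p`-vector space of dimension `≥ r`; a basis transported along `ν ↦ 1 ⊗ ν`, injective on `Cl[p^∞]`);
§2 feeds them to `KummerRadical.exists_independent_kummer_characters` (file `…KummerManyCharacters`: Minkowski unit + `r` class
radicals ⟹ `r + 1` independent admissible characters), also in the reflection-pair currency `(χ̄ odd, ψ̄ = ā χ̄⁻¹)` of w2 g11's
p685598 §3 / w4 g10's p685197; §3 applies the family supply count on the class
(`SelmerCount.pow_card_le_natCard_selmerGroup_of_forall_exists_adaptedRoot_of_characters_of_cmRamified`, file
`…SelmerCountCharacterSupplyFamily`). NET, with w4 g10's upper bound: on CASE R members with (LA),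
**`r + 1 ≤ dim_𝔽_p Sel_p(W/ℚ) ≤ 2 + 2·r_max`** where `p^r ≤ #(e_{θ_e})[p] ≤ p^{r_max}` over the abelian realisations — the
first-order census of B1-sha is now two-sided in the `p`-rank of ONE class-group component.

* §1 `exists_independent_eigenclasses_of_pow_le_natCard_torsion` — `K/ℚ` Galois, `p ∤ [K:ℚ]`, `θ` with shadow `e`,
  `p^r ≤ #{y ∈ e_θ(ℤ_p ⊗ Cl K) | p y = 0}` ⊢ `x : Fin r → Cl(𝓞 K)`, `x_i^p = 1`, `σ·x_i = e σ • x_i`, `𝔽_p`-independent.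
* §2 `exists_independent_kummer_characters_of_pow_le_natCard_torsion` (even `θ`-currency),
  **`exists_independent_kummer_characters_of_odd_character_of_pow_le`** (reflection-pair currency, exponent `(χ̄ γ̄).val`).
* §3 **`pow_succ_le_natCard_selmerGroup_of_forall_exists_adaptedRoot_of_pow_le_evenChiTorsion_of_cmRamified`** — hypotheses of
  p685598 §3 VERBATIM with `classGroupChiCard … ≠ 1` replaced by `p^r ≤ #(e_{ω∘ψ̄}(ℤ_p ⊗ Cl K))[p]` ⊢
  `p^{r+1} ≤ #Sel_p(W/ℚ)` ∧ `p^r ≤ #(Ш(W/ℚ) ⊓ Ш[p])`.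

THEOREMS ONLY; no definition, no named fact, no `sorry`. References: [Washington1997] §6.3, §10.2 (Thm. 10.9 and its proof);
[Gras2003] Ch. II §5.4 (Spiegelungssatz in `p`-ranks); [Lang1983AbelianVarieties] Ch. VII §1 (`N(p) = ℤ_p ⊗ N`);
[MilneADT2006] I Thm. 2.8; [SilvermanAEC2009] Thm. X.4.2.
-/

set_option autoImplicit false
-- `…BirchSwinnertonDyer.BirchSwinnertonDyer.Theorems…` is the problem's mandated namespace (D-0017).
set_option linter.dupNamespace false

noncomputable section

namespace Summit.BirchSwinnertonDyer.BirchSwinnertonDyer.Theorems.PrintCFram.KummerRadical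

open Literature.NumberTheory.NumberFields Literature.RepresentationTheory.FiniteGroups
open Literature.NumberTheory.GaloisRepresentations
open Literature.Geometry.Kaehler.FiniteAddGroup
open NumberField IsDedekindDomain Field Module
open scoped TensorProduct

/-! ## §1 From the `p`-rank of the `θ`-component to an independent family of eigenclasses -/

section Eigenclasses

variable {K : Type} [Field K] [NumberField K] [IsGalois ℚ K] {p : ℕ} [hp : Fact p.Prime]

/-- **`r` INDEPENDENT EIGENCLASSES FROM `p`-RANK `≥ r`.** Let `K/ℚ` be Galois with `p ∤ [K : ℚ]`, `θ : Gal(K/ℚ) →* ℤ_pˣ` with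
integer shadow `e` (`‖θ σ − e σ‖ < 1`), and suppose the `p`-torsion of the `θ`-component of the `p`-class group has at least `p^r`
elements: `p^r ≤ #{y ∈ e_θ(ℤ_p ⊗ Cl(𝓞 K)) | p • y = 0}`. Then there are ideal classes `x_1, …, x_r` with `x_i^p = 1`,
`σ · x_i = e σ • x_i` for every `σ`, which are `𝔽_p`-INDEPENDENT: `∏ x_i^{n_i} = 1 ⟹ p ∣ n_i` for all `i` («`rank_p (ε_θ A) ≥ r
⟹ A[p]` contains `r` independent `θ̄`-eigenvectors»). Proof: the `p`-torsion `T` of the component is an `𝔽_p`-vector space with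
`#T = p^{dim T}`, so `dim T ≥ r`; take `r` vectors of a basis; each is `1 ⊗ ν_i` with `ν_i ∈ Cl[p^∞]` an exact `e`-eigenclass killed
by `p` (as in `exists_eigenclass_of_classGroupChiComponent_ne_bot`); a relation `∑ n_i ν_i = 0` maps to `∑ n_i y_i = 0` in `T`.
[cite: Washington1997, §6.3 and §10.2] [cite: Lang1983AbelianVarieties, Ch. VII §1, Theorem 1 (proof), p. 182] -/
theorem exists_independent_eigenclasses_of_pow_le_natCard_torsion (hpK : ¬ p ∣ Module.finrank ℚ K)
    (θ : (K ≃ₐ[ℚ] K) →* ℤ_[p]ˣ) (e : (K ≃ₐ[ℚ] K) → ℕ)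
    (hθe : ∀ σ : K ≃ₐ[ℚ] K, ‖((θ σ : ℤ_[p]ˣ) : ℤ_[p]) - (e σ : ℤ_[p])‖ < 1) {r : ℕ}
    (hr : p ^ r ≤ Nat.card {y : ↥(classGroupChiComponent ℚ K p (fun g => ((θ g : ℤ_[p]ˣ) : ℤ_[p]))) // p • y = 0}) :
    ∃ x : Fin r → ClassGroup (𝓞 K), (∀ i, x i ^ p = 1) ∧
      (∀ (i : Fin r) (σ : K ≃ₐ[ℚ] K), classGroupRep ℚ K σ (Additive.ofMul (x i)) = e σ • Additive.ofMul (x i)) ∧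
      ∀ n : Fin r → ℕ, ∏ i, x i ^ n i = 1 → ∀ i, p ∣ n i := by
  classical
  haveI : NeZero p := ⟨hp.out.ne_zero⟩
  set N := Additive (ClassGroup (𝓞 K)) with hN
  set C := classGroupChiComponent ℚ K p (fun g => ((θ g : ℤ_[p]ˣ) : ℤ_[p])) with hC
  -- the `p`-torsion `T` of the component, an `𝔽_p`-vector space
  set T : AddSubgroup ↥C := AddSubgroup.torsionBy (↥C) p with hT
  letI : Module (ZMod p) T := AddSubgroup.torsionBy.zmodModule
  haveI : Module.Finite (ZMod p) T := Module.Finite.of_finite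
  have hcardT : Nat.card T = p ^ Module.finrank (ZMod p) T := by
    rw [Module.natCard_eq_pow_finrank (K := ZMod p), Nat.card_zmod]
  have hTeq : Nat.card T = Nat.card {y : ↥C // p • y = 0} :=
    Nat.card_congr (Equiv.subtypeEquivRight fun y => AddSubgroup.torsionBy.nsmul_iff)
  have hrd : r ≤ Module.finrank (ZMod p) T :=
    (Nat.pow_le_pow_iff_right hp.out.one_lt).1 (by rw [← hcardT, hTeq]; exact hr)
  -- `r` linearly independent vectors of `T`
  let b := Module.finBasis (ZMod p) T
  let y : Fin r → T := fun i => b (Fin.castLE hrd i)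
  have hli : LinearIndependent (ZMod p) y := b.linearIndependent.comp _ (Fin.castLE_injective hrd)
  have hli' : ∀ g : Fin r → ZMod p, ∑ i, g i • y i = 0 → ∀ i, g i = 0 := Fintype.linearIndependent_iff.1 hli
  -- the action on the component
  have hG : IsUnit (Fintype.card (K ≃ₐ[ℚ] K) : ℤ_[p]) := by
    rw [← Nat.card_eq_fintype_card, IsGalois.card_aut_eq_finrank, PadicInt.isUnit_iff, PadicInt.norm_natCast_eq_one_iff]
    exact (Nat.Prime.coprime_iff_not_dvd hp.out).2 hpK
  have hpy : ∀ i, (p : ℤ_[p]) • (((y i : ↥C) : ℤ_[p] ⊗[ℤ] N)) = 0 := fun i => by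
    have h := congrArg (fun z : T => (((z : ↥C) : ℤ_[p] ⊗[ℤ] N))) (AddSubgroup.torsionBy.nsmul (y i))
    simp only [AddSubgroupClass.coe_nsmul, Submodule.coe_smul_of_tower, ZeroMemClass.coe_zero] at h
    rw [Nat.cast_smul_eq_nsmul]
    exact h
  have heig : ∀ (i : Fin r) (σ : K ≃ₐ[ℚ] K),
      pClassGroupRep ℚ K p σ ((y i : ↥C) : ℤ_[p] ⊗[ℤ] N) = (e σ : ℤ_[p]) • ((y i : ↥C) : ℤ_[p] ⊗[ℤ] N) := by
    intro i σ
    rw [(mem_chiComponent_character_iff (pClassGroupRep ℚ K p) θ hG _).1 (y i : ↥C).2 σ]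
    obtain ⟨w, hw⟩ := (PadicInt.norm_lt_one_iff_dvd _).1 (hθe σ)
    have h1 : (((θ σ : ℤ_[p]ˣ) : ℤ_[p]) - (e σ : ℤ_[p])) • ((y i : ↥C) : ℤ_[p] ⊗[ℤ] N) = 0 := by
      rw [hw, mul_comm, mul_smul, hpy, smul_zero]
    rwa [sub_smul, sub_eq_zero] at h1
  -- `y_i = 1 ⊗ ν_i`, `ν_i` in the `p`-primary part
  have Hν := fun i => exists_mem_primaryComponent_toPadicTensor_eq (N := N) (p := p) ((y i : ↥C) : ℤ_[p] ⊗[ℤ] N)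
  choose ν hνP hνy using Hν
  have hinj := toPadicTensor_injOn (N := N) (p := p)
  have hstab : ∀ (σ : K ≃ₐ[ℚ] K) (v : N), v ∈ AddCommGroup.primaryComponent N p →
      classGroupRep ℚ K σ v ∈ AddCommGroup.primaryComponent N p := by
    intro σ v hv
    obtain ⟨k, hk⟩ := (AddCommGroup.mem_primaryComponent).1 hv
    exact (AddCommGroup.mem_primaryComponent).2 ⟨k, by rw [← map_nsmul, hk, map_zero]⟩
  have hPsum : ∀ n : Fin r → ℕ, ∑ i, n i • ν i ∈ AddCommGroup.primaryComponent N p := fun n =>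
    AddSubgroup.sum_mem _ fun i _ => AddSubgroup.nsmul_mem _ (hνP i) _
  refine ⟨fun i => Additive.toMul (ν i), fun i => ?_, fun i σ => ?_, fun n hn => ?_⟩
  · -- `x_i ^ p = 1`: `1 ⊗ (p ν_i) = p y_i = 0`
    have hpν : p • ν i = 0 := by
      refine hinj (AddSubgroup.nsmul_mem _ (hνP i) p) (zero_mem _) ?_
      rw [map_nsmul, hνy, map_zero, ← Nat.cast_smul_eq_nsmul ℤ_[p], hpy]
    have h := congrArg Additive.toMul hpν
    rwa [toMul_nsmul, toMul_zero] at h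
  · -- eigen-relation
    rw [ofMul_toMul]
    have hmem : classGroupRep ℚ K σ (ν i) - e σ • ν i ∈ AddCommGroup.primaryComponent N p :=
      sub_mem (hstab σ (ν i) (hνP i)) (AddSubgroup.nsmul_mem _ (hνP i) _)
    have hzero : classGroupRep ℚ K σ (ν i) - e σ • ν i = 0 := by
      refine hinj hmem (zero_mem _) ?_
      rw [map_sub, map_nsmul, map_zero, sub_eq_zero, hνy, toPadicTensor_apply, ← baseChangeRep_apply_tmul ℤ_[p],
        ← toPadicTensor_apply N p (ν i), hνy, ← Nat.cast_smul_eq_nsmul ℤ_[p]]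
      exact heig i σ
    exact sub_eq_zero.1 hzero
  · -- independence: `∑ n_i ν_i = 0 ⟹ ∑ n_i y_i = 0` in `T` ⟹ `n_i ≡ 0 (mod p)`
    have hsumν : ∑ i, n i • ν i = 0 := by
      have h := congrArg Additive.ofMul hn
      rw [ofMul_prod, ofMul_one] at h
      simpa only [ofMul_pow, ofMul_toMul] using h
    have hsumV : ∑ i, n i • (((y i : ↥C) : ℤ_[p] ⊗[ℤ] N)) = 0 := by
      have h := congrArg (toPadicTensor N p) hsumν
      rw [map_sum, map_zero] at h
      simpa only [map_nsmul, hνy] using h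
    have hsumT : ∑ i, n i • y i = 0 := by
      apply Subtype.ext
      apply Subtype.ext
      have h1 : ((((∑ i, n i • y i : T) : ↥C) : ℤ_[p] ⊗[ℤ] N)) = ∑ i, n i • (((y i : ↥C) : ℤ_[p] ⊗[ℤ] N)) := by
        simp only [AddSubmonoidClass.coe_finsetSum, AddSubgroupClass.coe_nsmul, Submodule.coe_smul_of_tower]
      rw [h1, hsumV]
      rfl
    have hg := hli' (fun i => (n i : ZMod p)) (by
      rw [← hsumT]
      exact Finset.sum_congr rfl fun i _ => Nat.cast_smul_eq_nsmul _ _ _)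
    intro i
    exact (ZMod.natCast_eq_zero_iff _ _).1 (hg i)

end Eigenclasses

/-! ## §2 `p`-rank `≥ r` ⟹ `r + 1` independent admissible Kummer characters -/

section Characters

open Literature.NumberTheory.EllipticCurves.Kato2004 HerbrandKummer

variable {K : Type} [Field K] [NumberField K] [IsCMField K] [IsGalois ℚ K] {p : ℕ} [hp : Fact p.Prime]

/-- **`rank_p e_θ(ℤ_p ⊗ Cl K) ≥ r` ⟹ `r + 1` independent admissible Kummer characters (even `θ`-currency).** `K` CM, Galois
over `ℚ`, `p ∤ [K:ℚ]`, `ζ ∈ K` a primitive `p`-th root of unity with `σζ = ζ^{a σ}`; `θ : Gal(K/ℚ) →* ℤ_pˣ` EVEN, `≠ 1`, with shadow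
`e`; `p^r ≤ #{y ∈ e_θ(ℤ_p ⊗ Cl(𝓞 K)) | p • y = 0}`. Then there is a family `κ : Option (Fin r) → (Γ_K →* ℤ/p)` of characters with
open kernels, killing the inertia above every `v ∤ p`, with the conjugation law `κ_j(θ_γ σ) = κ_j(σ)^{a γ̄ · e γ̄⁻¹}`, JOINTLY
INDEPENDENT (`∏ κ_j^{n_j} = 1 ⟹ ∀ j, p ∣ n_j`). [cite: Washington1997, §10.2 (proof of Thm. 10.9)] [cite: Gras2003, Ch. II §5.4] -/
theorem exists_independent_kummer_characters_of_pow_le_natCard_torsion (hpK : ¬ p ∣ Module.finrank ℚ K) {ζ : K}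
    (hζ : IsPrimitiveRoot ζ p) (a : (K ≃ₐ[ℚ] K) → ℕ) (ha : ∀ σ₀ : K ≃ₐ[ℚ] K, σ₀ ζ = ζ ^ a σ₀)
    (θ : (K ≃ₐ[ℚ] K) →* ℤ_[p]ˣ) (hθ1 : θ ≠ 1) (hθc : θ ((IsCMField.complexConj K).restrictScalars ℚ) = 1)
    (e : (K ≃ₐ[ℚ] K) → ℕ) (hθe : ∀ σ, ‖((θ σ : ℤ_[p]ˣ) : ℤ_[p]) - (e σ : ℤ_[p])‖ < 1) {r : ℕ}
    (hr : p ^ r ≤ Nat.card {y : ↥(classGroupChiComponent ℚ K p (fun g => ((θ g : ℤ_[p]ˣ) : ℤ_[p]))) // p • y = 0}) :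
    ∃ κ : Option (Fin r) → (absoluteGaloisGroup K →* Multiplicative (ZMod p)),
      (∀ j, IsOpen ((κ j).ker : Set (absoluteGaloisGroup K)) ∧
        (∀ v : HeightOneSpectrum (𝓞 K), ((p : ℕ) : 𝓞 K) ∉ v.asIdeal →
          ∀ 𝔔 ∈ v.primesAbove, ∀ g ∈ 𝔔.inertia (absoluteGaloisGroup K), κ j g = 1) ∧
        ∀ (γ : absoluteGaloisGroup ℚ) (σ : absoluteGaloisGroup K),
          κ j (absGaloisOuterConj ℚ K γ σ) = κ j σ ^ (a (absGaloisQuot ℚ K γ) * e (absGaloisQuot ℚ K γ)⁻¹)) ∧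
      ∀ n : Option (Fin r) → ℕ, ∏ j, κ j ^ n j = 1 → ∀ j, p ∣ n j := by
  obtain ⟨x, hxp, hxe, hind⟩ := exists_independent_eigenclasses_of_pow_le_natCard_torsion hpK θ e hθe hr
  exact exists_independent_kummer_characters hpK hζ a ha θ hθ1 hθc e hθe x hxp hxe hind

/-- **`rank_p e_{ω∘ψ̄}(ℤ_p ⊗ Cl K) ≥ r` ⟹ `r + 1` independent admissible Kummer characters, reflection-pair currency.** `K` CM,
Galois over `ℚ`, `p ∤ [K : ℚ]`, `ζ ∈ K` a primitive `p`-th root of unity with `σ ζ = ζ^{a σ}`; `χ̄ : Gal(K/ℚ) →* (ℤ/p)ˣ` ODD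
(`χ̄(c) = −1`), `ψ̄` its reflection (`ψ̄ σ = a σ · χ̄(σ)⁻¹`, even), `ψ̄ ≠ 1`; and `p^r ≤ #{y ∈ e_{ω∘ψ̄}(ℤ_p ⊗ Cl(𝓞 K)) | p • y = 0}`
(`ω∘ψ̄ = teichmullerChar p ∘ ψ̄`, the component of w4 g10's `hEt`). Then there is a family `κ : Option (Fin r) → (Γ_K →* ℤ/p)` with open
kernels, trivial on the inertia above every `v ∤ p`, `χ̄`-isotypic (`κ_j(θ_γ σ) = κ_j(σ)^{χ̄(γ̄)}`, exponent `(χ̄ γ̄).val`) and jointly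
independent. With w7 g4's upper bound p681948 this pins `p^{r+1} ≤ #V ≤ p · #e_{ω∘ψ̄}(ℤ_p ⊗ Cl K)` for the group `V` of admissible
`χ̄`-isotypic characters (Leopoldt's reflection in `p`-ranks, lower half). The case `r = 1` is
`exists_two_independent_kummer_characters_of_odd_character`. [cite: Washington1997, §10.2 (Thm. 10.9, proof)]
[cite: Gras2003, Ch. II §5.4 (reflection theorem)] -/
theorem exists_independent_kummer_characters_of_odd_character_of_pow_le (hpK : ¬ p ∣ Module.finrank ℚ K) {ζ : K}
    (hζ : IsPrimitiveRoot ζ p) (a : (K ≃ₐ[ℚ] K) → ℕ) (ha : ∀ σ₀ : K ≃ₐ[ℚ] K, σ₀ ζ = ζ ^ a σ₀)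
    (χb : (K ≃ₐ[ℚ] K) →* (ZMod p)ˣ) (hoddχ : χb ((IsCMField.complexConj K).restrictScalars ℚ) = -1)
    (ψb : (K ≃ₐ[ℚ] K) →* (ZMod p)ˣ) (hψb1 : ψb ≠ 1)
    (hψb : ∀ σ : K ≃ₐ[ℚ] K, ((ψb σ : (ZMod p)ˣ) : ZMod p) = (a σ : ZMod p) * (((χb σ)⁻¹ : (ZMod p)ˣ) : ZMod p)) {r : ℕ}
    (hr : p ^ r ≤ Nat.card {y : ↥(classGroupChiComponent ℚ K p
      (fun g => ((((teichmullerChar p).comp ψb) g : ℤ_[p]ˣ) : ℤ_[p]))) // p • y = 0}) :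
    ∃ κ : Option (Fin r) → (absoluteGaloisGroup K →* Multiplicative (ZMod p)),
      (∀ j, IsOpen ((κ j).ker : Set (absoluteGaloisGroup K)) ∧
        (∀ v : HeightOneSpectrum (𝓞 K), ((p : ℕ) : 𝓞 K) ∉ v.asIdeal →
          ∀ 𝔔 ∈ v.primesAbove, ∀ g ∈ 𝔔.inertia (absoluteGaloisGroup K), κ j g = 1) ∧
        ∀ (γ : absoluteGaloisGroup ℚ) (σ : absoluteGaloisGroup K),
          κ j (absGaloisOuterConj ℚ K γ σ) = κ j σ ^ ((χb (absGaloisQuot ℚ K γ) : (ZMod p)ˣ) : ZMod p).val) ∧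
      ∀ n : Option (Fin r) → ℕ, ∏ j, κ j ^ n j = 1 → ∀ j, p ∣ n j := by
  classical
  -- the even radical character `θ = ω ∘ ψ̄` and its integer shadow `e = val ∘ ψ̄`
  have hθe : ∀ σ : K ≃ₐ[ℚ] K, ‖((((teichmullerChar p).comp ψb) σ : ℤ_[p]ˣ) : ℤ_[p]) -
      ((((ψb σ : (ZMod p)ˣ) : ZMod p).val : ℕ) : ℤ_[p])‖ < 1 := fun σ =>
    norm_teichmullerChar_comp_sub_lt_one ψb σ _ (ZMod.natCast_zmod_val _).symm
  have hθc : ((teichmullerChar p).comp ψb) ((IsCMField.complexConj K).restrictScalars ℚ) = 1 := by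
    have h1 : ((ψb ((IsCMField.complexConj K).restrictScalars ℚ) : (ZMod p)ˣ) : ZMod p) = 1 := by
      rw [hψb, hoddχ, inv_neg_one, Units.val_neg, Units.val_one, natCast_cycloExp_complexConj hp.out hζ a ha]
      ring
    have h2 : ψb ((IsCMField.complexConj K).restrictScalars ℚ) = 1 := Units.ext (by rw [h1, Units.val_one])
    rw [MonoidHom.comp_apply, h2, map_one]
  have hθ1 : (teichmullerChar p).comp ψb ≠ 1 := by
    intro h
    apply hψb1
    ext σ
    have h3 := DFunLike.congr_fun h σ
    rw [MonoidHom.comp_apply, MonoidHom.one_apply, ← (teichmullerChar p).map_one] at h3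
    rw [teichmullerChar_injective p h3, MonoidHom.one_apply]
  obtain ⟨κ, hκ, hind⟩ := exists_independent_kummer_characters_of_pow_le_natCard_torsion hpK hζ a ha
    ((teichmullerChar p).comp ψb) hθ1 hθc (fun σ => ((ψb σ : (ZMod p)ˣ) : ZMod p).val) hθe hr
  -- the exponent `a(γ̄) · ψ̄(γ̄⁻¹) ≡ χ̄(γ̄) (mod p)`
  have hexp : ∀ τ : K ≃ₐ[ℚ] K,
      ((a τ * ((ψb τ⁻¹ : (ZMod p)ˣ) : ZMod p).val : ℕ) : ZMod p) = ((((χb τ : (ZMod p)ˣ) : ZMod p).val : ℕ) : ZMod p) := by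
    intro τ
    have h1 : (a τ : ZMod p) = ((ψb τ : (ZMod p)ˣ) : ZMod p) * ((χb τ : (ZMod p)ˣ) : ZMod p) := by
      rw [hψb τ, mul_assoc, Units.inv_mul, mul_one]
    rw [Nat.cast_mul, ZMod.natCast_zmod_val, ZMod.natCast_zmod_val, map_inv, h1, mul_right_comm, Units.mul_inv, one_mul]
  refine ⟨κ, fun j => ⟨(hκ j).1, (hκ j).2.1, fun γ σ => ?_⟩, hind⟩
  exact ((hκ j).2.2 γ σ).trans (multiplicative_zmod_pow_eq_pow_of_natCast_eq _ (hexp _))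

end Characters

end Summit.BirchSwinnertonDyer.BirchSwinnertonDyer.Theorems.PrintCFram.KummerRadical

/-! ## §3 On the CM-ramified class: the `p`-rank lower bound for `Sel_p` and `Ш[p]` -/

namespace Summit.BirchSwinnertonDyer.BirchSwinnertonDyer.Theorems.PrintCFram.SelmerCount

open scoped Classical
open NumberField IsDedekindDomain Field WeierstrassCurve
open Literature.NumberTheory.EllipticCurves Literature.NumberTheory.GaloisRepresentations
  Literature.NumberTheory.EllipticCurves.GreenbergSelmer Literature.NumberTheory.EllipticCurves.Rank1Residual
  Literature.NumberTheory.NumberFields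
open Summit.BirchSwinnertonDyer.Rank1Residual.X2.ResidualDevissageModules

section Class

variable (W : WeierstrassCurve ℚ) [W.IsElliptic] [W.IsGloballyMinimal]
variable {p : ℕ} [hp : Fact p.Prime]

/-- **THE `p`-RANK LOWER BOUND OF THE B1-sha CENSUS (granted the local Euler characteristic).** Class member `W/ℚ` (globally
minimal, CM, `CMRamified W p`, `p ≥ 5`) of rank one; `v ∋ p`; `Φ ≤ W[p]` a stable line of order `p` with character `θ : Γ_ℚ →* 𝔽_pˣ`
satisfying w6 g4's (LA) at `v` (CASE R when `Φ` carries the odd character); `K` a CM field, Galois over `ℚ`, `p ∤ [K:ℚ]`, `θ(res Γ_K) = 1`,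
`ζ ∈ K` a primitive `p`-th root of unity with `σ ζ = ζ^{a σ}`; `χ̄ : Gal(K/ℚ) →* 𝔽_pˣ` the DESCENT of `θ` (`χ̄(γ̄) = θ(γ)`), ODD, and `ψ̄`
its reflection (`ψ̄ σ = a σ · χ̄(σ)⁻¹`), `ψ̄ ≠ 1`; and **`p^r ≤ #(e_{ω∘ψ̄}(ℤ_p ⊗ Cl(𝓞 K)))[p]`** (the `p`-torsion of the component of
the Teichmüller lift of `ψ̄` — EXACTLY the quantity `t` bounds from above in w4 g10's
`natCard_selmerGroup_le_sq_mul_sq_of_evenChiTorsion_le`, p685197); ASSUME `localEulerPoincareCharacteristic ℚ_v`. THEN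
**`p^{r+1} ≤ #Sel_p(W/ℚ)`** and **`p^r ≤ #(Ш(W/ℚ) ⊓ Ш[p])`**: `r` independent even eigenclasses (§1) ⟹ `r + 1` independent admissible
`χ̄`-isotypic Kummer characters of `Γ_K` (§2) ⟹ `p^{r+1} ≤ #R_rel(Φ) ≤ #Sel_p = p·#Ш[p]` (family supply count under (LA)). So on
CASE R members the first-order census reads, in the `p`-rank `r = rank_p e_{θ_e}` of ONE class-group component:
`r = 0 ⟹ Ш(W)[p] = 0` (w2 g10 / w4 g10, mod CT + GZK) and `r ≥ 1 ⟹ r ≤ dim_𝔽_p Ш(W)[p] ≤ 1 + 2r` (this theorem + p685197, mod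
Milne I 2.8 / CT + GZK). [cite: Washington1997, §10.2 (Thm. 10.9)] [cite: Gras2003, Ch. II §5.4] [cite: MilneADT2006, Ch. I §2 Thm. 2.8]
[cite: SilvermanAEC2009, Thm. X.4.2] -/
theorem pow_succ_le_natCard_selmerGroup_of_forall_exists_adaptedRoot_of_pow_le_evenChiTorsion_of_cmRamified
    (hCM : W.HasCM) (hram : CMRamified W p) (h5 : 5 ≤ p) (hrank : W.mordellWeilRank = 1)
    {v : HeightOneSpectrum (𝓞 ℚ)} (hpv : ((p : ℕ) : 𝓞 ℚ) ∈ v.asIdeal)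
    (hEP : localEulerPoincareCharacteristic (v.adicCompletion ℚ))
    (Φ : StableSubgroup (absoluteGaloisGroup ℚ) (geomTorsion W (p : ℤ))) (hcard : Nat.card Φ.Sub = p)
    (hLA : ∀ P : (W.baseChange (v.adicCompletion ℚ)).toAffine.Point,
      ∃ R : localPoints W (v.adicCompletion ℚ),
        (p : ℤ) • R = Affine.Point.map (W' := W)
          (IsScalarTower.toAlgHom ℚ (v.adicCompletion ℚ) (AlgebraicClosure (v.adicCompletion ℚ))) P ∧
        ∀ σ : absoluteGaloisGroup (v.adicCompletion ℚ), ∃ t ∈ Φ.toAddSubgroup,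
          σ • R - R = pointsMap W (v.adicCompletion ℚ) (t : geomPoints W))
    (θ : absoluteGaloisGroup ℚ →* (ZMod p)ˣ)
    (hθ : ∀ (g : absoluteGaloisGroup ℚ) (s : Φ.Sub), g • s = (((θ g : ZMod p).val : ℕ) : ℤ) • s)
    {K : Type} [Field K] [NumberField K] [IsCMField K] [IsGalois ℚ K] (hpK : ¬ p ∣ Module.finrank ℚ K)
    (hrK : ∀ σ : absoluteGaloisGroup K, θ (absGaloisRestrict ℚ K σ) = 1)
    {ζ : K} (hζ : IsPrimitiveRoot ζ p) (a : (K ≃ₐ[ℚ] K) → ℕ) (ha : ∀ σ₀ : K ≃ₐ[ℚ] K, σ₀ ζ = ζ ^ a σ₀)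
    (χb : (K ≃ₐ[ℚ] K) →* (ZMod p)ˣ) (hχb : ∀ γ : absoluteGaloisGroup ℚ, χb (absGaloisQuot ℚ K γ) = θ γ)
    (hoddχ : χb ((IsCMField.complexConj K).restrictScalars ℚ) = -1)
    (ψb : (K ≃ₐ[ℚ] K) →* (ZMod p)ˣ) (hψb1 : ψb ≠ 1)
    (hψb : ∀ σ : K ≃ₐ[ℚ] K, ((ψb σ : (ZMod p)ˣ) : ZMod p) = (a σ : ZMod p) * (((χb σ)⁻¹ : (ZMod p)ˣ) : ZMod p)) {r : ℕ}
    (hr : p ^ r ≤ Nat.card {y : ↥(classGroupChiComponent ℚ K p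
      (fun g => ((((Kato2004.teichmullerChar p).comp ψb) g : ℤ_[p]ˣ) : ℤ_[p]))) // p • y = 0}) :
    p ^ (r + 1) ≤ Nat.card (selmerGroup W (p : ℤ)) ∧
      p ^ r ≤ Nat.card (W.sha ⊓ AddSubgroup.torsionBy W.galH1 p : AddSubgroup W.galH1) := by
  obtain ⟨κ, hκ, hind⟩ :=
    KummerRadical.exists_independent_kummer_characters_of_odd_character_of_pow_le hpK hζ a ha χb hoddχ ψb hψb1 hψb hr
  have h := pow_card_le_natCard_selmerGroup_of_forall_exists_adaptedRoot_of_characters_of_cmRamified W hCM hram h5 hrank hpv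
    hEP Φ hcard hLA θ hθ hpK hrK κ (fun j => (hκ j).1) (fun j => (hκ j).2.1)
    (fun j γ σ => by rw [(hκ j).2.2 γ σ, hχb]) hind
  rwa [Fintype.card_option, Fintype.card_fin, Nat.add_sub_cancel] at h

end Class

end Summit.BirchSwinnertonDyer.BirchSwinnertonDyer.Theorems.PrintCFram.SelmerCount

end
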